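import Literature.MathematicalPhysics.QuantumLattice.InfVolFermionState
import Literature.Analysis.UnboundedOperators.UnitaryRepSpectralMeasure
import HarnessLib

/-!
# Correlation functions of translation-invariant lattice fermion states are positive definite

Topic `Literature/MathematicalPhysics/QuantumLattice`; companion of `InfVolFermionState.lean`
(`InfVolFermionState d`, `InfVolFermionState.corr`, `InfVolFermionState.IsTranslationInvariant`,
`fermionEmbed (PolySite.shiftEmb v Λ)` = the lattice translation `Γ(τ_v) : 𝔄_Λ → 𝔄_{Λ+v}`) and of
`Literature/Analysis/FunctionSpaces/NuclearSpace.lean` (`IsPositiveDefinite`, Bochner's convention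
`∑ᵢⱼ conj cᵢ · cⱼ · C (xⱼ - xᵢ) ≥ 0`), written for the consumer
`Literature.Analysis.FunctionSpaces.IsPositiveDefinite.exists_measure_integral_exp_eq` (Herglotz's
theorem on `ℤᵈ`, `HerglotzTheorem.lean`): `Site d = Fin d → ℤ`, so the conclusions below feed it
verbatim.

## What is proved (all elementary; no named fact, no sorry)

* **Gram positivity** (`InfVolFermionState.corr_gram_nonneg`): for every infinite-volume state `ω`,
  every finite family of local observables `Aᵢ ∈ 𝔄_{Λᵢ}` and coefficients `cᵢ ∈ ℂ`,
  `0 ≤ ∑ᵢ ∑ⱼ conj cᵢ · cⱼ · ω(Aᵢ⋆ Aⱼ)` (the observables embedded by isotony into the local algebra of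
  `⋃ Λᵢ`; this is `ω(B⋆B) ≥ 0` for `B = ∑ cⱼ Aⱼ`). Bratteli–Robinson I, §2.3.3 (positivity of states,
  the GNS inner product `⟨π(A)Ω, π(B)Ω⟩ = ω(A⋆B)`).
* **Translation covariance of the two-point function**
  (`IsTranslationInvariant.corr_fermionEmbed_shiftEmb`): `ω(τ_v A · τ_v B) = ω(A B)` for invariant `ω`.
* **Positive definiteness** (`IsTranslationInvariant.isPositiveDefinite_corr`): for a
  TRANSLATION-INVARIANT state `ω` of the CAR algebra over `ℤᵈ` and any local observable `A ∈ 𝔄_Λ`,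
  the function `r ↦ ω(A⋆ · τ_r A)` on `ℤᵈ` is positive definite:
  `∑ᵢⱼ conj cᵢ cⱼ ω(A⋆ τ_{xⱼ-xᵢ} A) = ω(B⋆B) ≥ 0` with `B = ∑ⱼ cⱼ τ_{xⱼ} A`, using
  `ω(τ_{xᵢ}A⋆ · τ_{xⱼ}A) = ω(A⋆ · τ_{xⱼ-xᵢ}A)`. This is the positive-type property of the matrix
  elements `r ↦ ⟨ψ, U(r) ψ⟩` of the unitary representation `U` of the translation group `ℤᵈ` on the
  GNS space of an invariant state (Bratteli–Robinson I, Cor. 2.3.17 and §4.3.1), the input of the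
  Herglotz–Bochner / SNAG spectral theorem; here it is proved directly from positivity and
  invariance, without the GNS construction.
* **Closure properties of positive-definite functions** used for symmetrised correlation functions:
  sums (`IsPositiveDefinite.add`, `.sum`, here), nonnegative real multiples (`.real_smul`) and
  precomposition with an additive homomorphism (`.comp_addMonoidHom`, both already in
  `Literature/Analysis/UnboundedOperators/UnitaryRepSpectralMeasure.lean`; e.g. a lattice point-group
  element, so orbit means of positive-definite functions are positive definite).
* **Density–density and one-site correlations** (`isPositiveDefinite_densityCorr`,
  `isPositiveDefinite_corr_oneSite`): for invariant `ω` and every real `ρ` the connected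
  density correlation function `r ↦ ω((n₀ - ρ)(n_r - ρ))`, `n_x = n_{x↑} + n_{x↓}`, is positive
  definite, and so is `r ↦ ω(a⋆ · τ_r a)` for any one-site observable `a ∈ 𝔄_{{0}}` (e.g. the spin
  components `S^α_0`, giving `r ↦ ω(S^α_0 S^α_r)` for Hermitian `a`).

## References

* [BratteliRobinsonI1987] O. Bratteli, D. W. Robinson, *Operator Algebras and Quantum Statistical
  Mechanics 1*, 2nd ed. (Springer 1987), §2.3.3 (positivity, GNS: Thm. 2.3.16, Cor. 2.3.17),
  §4.3.1 (invariant states and the unitary representation of the symmetry group).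
* [ArakiMoriya2003] H. Araki, H. Moriya, *Equilibrium statistical mechanics of fermion lattice
  systems*, Rev. Math. Phys. 15 (2003) 93, §4.1 (lattice translations `τ_k`, eq. (4.12)).
* [Bochner1933] S. Bochner, *Monotone Funktionen, Stieltjessche Integrale und harmonische Analyse*,
  Math. Ann. 108 (1933) 378, §1 (positive-definite functions).
* [BergChristensenRessel1984] C. Berg, J. P. R. Christensen, P. Ressel, *Harmonic Analysis on
  Semigroups*, GTM 100 (Springer 1984), §4.1.5–4.1.6 (`𝒫(S)` is a convex cone), Exercise 4.2.14
  (pull-back of positive-definite functions along a homomorphism).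
-/

noncomputable section

/-! ### §1. Closure properties of positive-definite functions -/

namespace Literature.Analysis.FunctionSpaces.IsPositiveDefinite

open scoped ComplexConjugate

variable {G : Type*} [AddGroup G]

/-- The sum of two positive-definite functions is positive definite: the positive-definite
functions form a convex cone. [cite: BergChristensenRessel1984, §4.1.6] [cite: Bochner1933, §1] -/
theorem add {C D : G → ℂ} (hC : IsPositiveDefinite C) (hD : IsPositiveDefinite D) :
    IsPositiveDefinite (C + D) := by
  intro n x c
  have h1 := hC n x c
  have h2 := hD n x c
  have hsplit : (∑ i, ∑ j, conj (c i) * c j * (C + D) (x j - x i)) =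
      (∑ i, ∑ j, conj (c i) * c j * C (x j - x i)) + ∑ i, ∑ j, conj (c i) * c j * D (x j - x i) := by
    simp only [Pi.add_apply, mul_add, Finset.sum_add_distrib]
  rw [hsplit, Complex.add_re, Complex.add_im]
  exact ⟨add_nonneg h1.1 h2.1, by rw [h1.2, h2.2, add_zero]⟩

/-- The zero function is positive definite (the apex of the convex cone `𝒫(G)`).
[cite: BergChristensenRessel1984, §4.1.6] -/
theorem zero : IsPositiveDefinite (fun _ : G => (0 : ℂ)) := by
  intro n x c
  simp

/-- A finite sum of positive-definite functions is positive definite (convex cone).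
[cite: BergChristensenRessel1984, §4.1.6] [cite: Bochner1933, §1] -/
theorem sum {ι : Type*} (s : Finset ι) {C : ι → G → ℂ} (hC : ∀ k ∈ s, IsPositiveDefinite (C k)) :
    IsPositiveDefinite (fun g => ∑ k ∈ s, C k g) := by
  classical
  induction s using Finset.induction_on with
  | empty => simpa only [Finset.sum_empty] using (zero (G := G))
  | @insert k s hk ih =>
    have hks : IsPositiveDefinite (C k) := hC k (Finset.mem_insert_self k s)
    have hs : IsPositiveDefinite (fun g => ∑ l ∈ s, C l g) := ih fun l hl => hC l (Finset.mem_insert_of_mem hl)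
    have := IsPositiveDefinite.add hks hs
    simpa [Finset.sum_insert hk, Pi.add_def] using this

end Literature.Analysis.FunctionSpaces.IsPositiveDefinite

namespace Literature.MathematicalPhysics.QuantumLattice

open Matrix Finset HubbardWave0 Literature.Probability.LatticeModels
open Literature.Analysis.FunctionSpaces
open scoped ComplexOrder ComplexConjugate

variable {d : ℕ}


/-! ### §2. Gram positivity of a state on finitely many local observables -/

namespace InfVolFermionState

variable (ω : InfVolFermionState d)

/-- **Gram positivity.** For local observables `Aᵢ ∈ 𝔄_{Λᵢ}` (`i < n`) and coefficients `cᵢ`,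
`0 ≤ ∑ᵢ ∑ⱼ conj cᵢ · cⱼ · ω(Aᵢ⋆ Aⱼ)` (in `ComplexOrder`: real part `≥ 0`, imaginary part `0`), the
two-point functions `ω(Aᵢ⋆ Aⱼ) = ω.corr Aᵢᴴ Aⱼ` being computed in the local algebra of `⋃ Λᵢ`:
this is `ω(B⋆ B) ≥ 0` for `B = ∑ⱼ cⱼ Aⱼ`. Bratteli–Robinson I §2.3.3 (the GNS inner product
`ω(A⋆B)` is positive semidefinite). [cite: BratteliRobinsonI1987, §2.3.3 (Thm. 2.3.16)] -/
theorem corr_gram_nonneg {n : ℕ} {Λs : Fin n → Finset (Site d)} (A : ∀ i, FermionOp (Λs i))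
    (c : Fin n → ℂ) :
    0 ≤ ∑ i, ∑ j, conj (c i) * c j * ω.corr (A i)ᴴ (A j) := by
  classical
  set U : Finset (Site d) := Finset.univ.biUnion Λs with hU
  have hsub : ∀ i, Λs i ⊆ U := fun i => Finset.subset_biUnion_of_mem Λs (Finset.mem_univ i)
  set B : FermionOp U := ∑ j, c j • fermionEmbed (PolySite.incl (hsub j)) (A j) with hB
  have hpos := ω.expect_nonneg U B
  have hexp : ω.expect U (Bᴴ * B) = ∑ i, ∑ j, conj (c i) * c j * ω.corr (A i)ᴴ (A j) := by
    have hBB : Bᴴ * B = ∑ i, ∑ j, (conj (c i) * c j) •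
        (fermionEmbed (PolySite.incl (hsub i)) (A i)ᴴ * fermionEmbed (PolySite.incl (hsub j)) (A j)) := by
      rw [hB, Matrix.conjTranspose_sum, Finset.sum_mul]
      refine Finset.sum_congr rfl fun i _ => ?_
      rw [Finset.mul_sum]
      refine Finset.sum_congr rfl fun j _ => ?_
      rw [Matrix.conjTranspose_smul, ← fermionEmbed_conjTranspose, Matrix.smul_mul, Matrix.mul_smul,
        smul_smul, Complex.star_def]
    rw [hBB, map_sum]
    refine Finset.sum_congr rfl fun i _ => ?_
    rw [map_sum]
    refine Finset.sum_congr rfl fun j _ => ?_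
    rw [map_smul, smul_eq_mul, ω.corr_eq_expect_of_subset (hsub i) (hsub j)]
  rw [← hexp]
  exact hpos

/-- Gram positivity, real/imaginary parts. [cite: BratteliRobinsonI1987, §2.3.3 (Thm. 2.3.16)] -/
theorem corr_gram_re_nonneg_and_im_eq_zero {n : ℕ} {Λs : Fin n → Finset (Site d)}
    (A : ∀ i, FermionOp (Λs i)) (c : Fin n → ℂ) :
    0 ≤ (∑ i, ∑ j, conj (c i) * c j * ω.corr (A i)ᴴ (A j)).re ∧
      (∑ i, ∑ j, conj (c i) * c j * ω.corr (A i)ᴴ (A j)).im = 0 := by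
  have h := Complex.nonneg_iff.1 (ω.corr_gram_nonneg A c)
  exact ⟨h.1, h.2.symm⟩

/-! ### §3. Translates of local observables and translation covariance -/

/-- Two successive lattice translations of a local observable agree with the single translation by
the sum, up to the isotony identification of the regions `Λ + u ⊆ (Λ + w) + v` (`w + v = u`):
`Γ(τ_v) (Γ(τ_w) A) = Γ(ι) (Γ(τ_u) A)`. Araki–Moriya (2003) §4.1 Def. 4.3 (`τ` is a group action).
[cite: ArakiMoriya2003, §4.1 Def. 4.3] -/
theorem shiftSet_subset_shiftSet_shiftSet {v w u : Site d} (h : w + v = u) (Λ : Finset (Site d)) :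
    shiftSet u Λ ⊆ shiftSet v (shiftSet w Λ) := fun x hx =>
  mem_shiftSet.2 (mem_shiftSet.2 (by
    rw [sub_sub, add_comm v w, h]; exact mem_shiftSet.1 hx))

/-- `Γ(τ_v) (Γ(τ_w) A) = Γ(ι_{Λ+u ⊆ (Λ+w)+v}) (Γ(τ_u) A)` for `w + v = u`.
[cite: ArakiMoriya2003, §4.1 Def. 4.3] -/
theorem fermionEmbed_shiftEmb_shiftEmb {v w u : Site d} (h : w + v = u) {Λ : Finset (Site d)}
    (A : FermionOp Λ) :
    fermionEmbed (PolySite.shiftEmb v (shiftSet w Λ)) (fermionEmbed (PolySite.shiftEmb w Λ) A) =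
      fermionEmbed (PolySite.incl (shiftSet_subset_shiftSet_shiftSet h Λ))
        (fermionEmbed (PolySite.shiftEmb u Λ) A) := by
  rw [fermionEmbed_fermionEmbed, fermionEmbed_fermionEmbed,
    fermionEmbed_congr (φ := (PolySite.shiftEmb w Λ).trans (PolySite.shiftEmb v (shiftSet w Λ)))
      (ψ := (PolySite.shiftEmb u Λ).trans (PolySite.incl (shiftSet_subset_shiftSet_shiftSet h Λ)))
      (fun y => Subtype.ext (by
        simp only [Function.Embedding.trans_apply, PolySite.coe_shiftEmb, PolySite.coe_incl,
          ofLex_toLex, add_assoc, h]))]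

variable {ω}

/-- **Translation covariance of the two-point function**: for translation-invariant `ω`,
`ω(τ_v A · τ_v B) = ω(A B)`. Araki–Moriya (2003) §4.1 eq. (4.12); Bratteli–Robinson I §4.3.1.
[cite: ArakiMoriya2003, §4.1 eq. (4.12)] -/
theorem IsTranslationInvariant.corr_fermionEmbed_shiftEmb (hω : ω.IsTranslationInvariant) (v : Site d)
    {Λ₁ Λ₂ : Finset (Site d)} (A : FermionOp Λ₁) (B : FermionOp Λ₂) :
    ω.corr (fermionEmbed (PolySite.shiftEmb v Λ₁) A) (fermionEmbed (PolySite.shiftEmb v Λ₂) B) =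
      ω.corr A B := by
  rw [← shift_corr, hω v]

/-- The two-point function of two translates of one observable only depends on the difference of
the translation vectors: `ω((τ_x A)⋆ · τ_y A) = ω(A⋆ · τ_{y-x} A)` for invariant `ω`.
[cite: ArakiMoriya2003, §4.1 eq. (4.12)] -/
theorem IsTranslationInvariant.corr_shiftEmb_conjTranspose_shiftEmb (hω : ω.IsTranslationInvariant)
    {Λ : Finset (Site d)} (A : FermionOp Λ) (x y : Site d) :
    ω.corr (fermionEmbed (PolySite.shiftEmb x Λ) A)ᴴ (fermionEmbed (PolySite.shiftEmb y Λ) A) =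
      ω.corr Aᴴ (fermionEmbed (PolySite.shiftEmb (y - x) Λ) A) := by
  have h : (y - x) + x = y := sub_add_cancel y x
  calc ω.corr (fermionEmbed (PolySite.shiftEmb x Λ) A)ᴴ (fermionEmbed (PolySite.shiftEmb y Λ) A)
      = ω.corr (fermionEmbed (PolySite.incl subset_rfl) (fermionEmbed (PolySite.shiftEmb x Λ) A)ᴴ)
          (fermionEmbed (PolySite.incl (shiftSet_subset_shiftSet_shiftSet h Λ))
            (fermionEmbed (PolySite.shiftEmb y Λ) A)) :=
        (ω.corr_fermionEmbed_incl subset_rfl (shiftSet_subset_shiftSet_shiftSet h Λ) _ _).symm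
    _ = ω.corr (fermionEmbed (PolySite.shiftEmb x Λ) Aᴴ)
          (fermionEmbed (PolySite.shiftEmb x (shiftSet (y - x) Λ))
            (fermionEmbed (PolySite.shiftEmb (y - x) Λ) A)) := by
        rw [PolySite.incl_rfl, fermionEmbed_refl_apply, fermionEmbed_conjTranspose,
          fermionEmbed_shiftEmb_shiftEmb h]
    _ = ω.corr Aᴴ (fermionEmbed (PolySite.shiftEmb (y - x) Λ) A) :=
        hω.corr_fermionEmbed_shiftEmb x _ _

/-! ### §4. Positive definiteness of correlation functions of invariant states -/

/-- **Correlation functions of translation-invariant states are positive definite.** For a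
translation-invariant state `ω` of the lattice fermion system on `ℤᵈ` and a local observable
`A ∈ 𝔄_Λ`, the function `r ↦ ω(A⋆ · τ_r A)` on `ℤᵈ` (two-point function of `A` and its translate,
`InfVolFermionState.corr`) is positive definite in Bochner's sense:
`∑ᵢⱼ conj cᵢ cⱼ ω(A⋆ τ_{xⱼ-xᵢ} A) = ω(B⋆ B) ≥ 0`, `B = ∑ⱼ cⱼ τ_{xⱼ} A`. (The positive-type property
of `r ↦ ⟨π(A)Ω, U(r) π(A)Ω⟩` for the unitary representation of `ℤᵈ` on the GNS space of `ω`,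
Bratteli–Robinson I Cor. 2.3.17 / §4.3.1; the input of Herglotz's theorem
`IsPositiveDefinite.exists_measure_integral_exp_eq`.)
[cite: BratteliRobinsonI1987, Cor. 2.3.17 and §4.3.1] -/
theorem IsTranslationInvariant.isPositiveDefinite_corr (hω : ω.IsTranslationInvariant)
    {Λ : Finset (Site d)} (A : FermionOp Λ) :
    IsPositiveDefinite (fun r : Site d => ω.corr Aᴴ (fermionEmbed (PolySite.shiftEmb r Λ) A)) := by
  intro n x c
  have hgram := ω.corr_gram_re_nonneg_and_im_eq_zero
    (Λs := fun i => shiftSet (x i) Λ) (fun i => fermionEmbed (PolySite.shiftEmb (x i) Λ) A) c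
  have hsum : (∑ i, ∑ j, conj (c i) * c j * ω.corr Aᴴ (fermionEmbed (PolySite.shiftEmb (x j - x i) Λ) A)) =
      ∑ i, ∑ j, conj (c i) * c j *
        ω.corr (fermionEmbed (PolySite.shiftEmb (x i) Λ) A)ᴴ (fermionEmbed (PolySite.shiftEmb (x j) Λ) A) := by
    refine Finset.sum_congr rfl fun i _ => Finset.sum_congr rfl fun j _ => ?_
    rw [hω.corr_shiftEmb_conjTranspose_shiftEmb A (x i) (x j)]
  rw [hsum]
  exact hgram

/-- Scalar form of the previous theorem at chosen points: for invariant `ω`, points `xᵢ` and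
coefficients `cᵢ`, `0 ≤ Re ∑ᵢⱼ conj cᵢ cⱼ ω(A⋆ τ_{xⱼ - xᵢ} A)` and the imaginary part vanishes.
[cite: BratteliRobinsonI1987, Cor. 2.3.17 and §4.3.1] -/
theorem IsTranslationInvariant.re_sum_corr_nonneg (hω : ω.IsTranslationInvariant)
    {Λ : Finset (Site d)} (A : FermionOp Λ) {n : ℕ} (x : Fin n → Site d) (c : Fin n → ℂ) :
    0 ≤ (∑ i, ∑ j, conj (c i) * c j *
        ω.corr Aᴴ (fermionEmbed (PolySite.shiftEmb (x j - x i) Λ) A)).re :=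
  (hω.isPositiveDefinite_corr A n x c).1

/-! ### §5. One-site observables: densities and spins -/

/-- Translating the number operator: `Γ(τ_v) n_{xσ} = n_{x+v,σ}`.
[cite: ArakiMoriya2003, §4.1 Def. 4.3] -/
theorem fermionEmbed_shiftEmb_nAt (v : Site d) {Λ : Finset (Site d)} (x : Site d) (hx : x ∈ Λ)
    (σ : Fin 2) :
    fermionEmbed (PolySite.shiftEmb v Λ) (nAt x hx σ) = nAt (x + v) (PolySite.add_mem_shiftSet v hx) σ := by
  rw [nAt, fermionEmbed_numberOp, PolySite.shiftEmb_pt]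

/-- The total site density `n_x = n_{x↑} + n_{x↓}` minus a real constant `ρ`, as an element of
`𝔄_Λ` (`x ∈ Λ`); the connected density correlation function of a state of density `ρ` is built from
it. [folklore] -/
private theorem fermionEmbed_shiftEmb_density_sub (v : Site d) {Λ : Finset (Site d)} (x : Site d) (hx : x ∈ Λ)
    (ρ : ℝ) :
    fermionEmbed (PolySite.shiftEmb v Λ) (nAt x hx 0 + nAt x hx 1 - (ρ : ℂ) • (1 : FermionOp Λ)) =
      nAt (x + v) (PolySite.add_mem_shiftSet v hx) 0 + nAt (x + v) (PolySite.add_mem_shiftSet v hx) 1 -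
        (ρ : ℂ) • (1 : FermionOp (shiftSet v Λ)) := by
  rw [map_sub, map_add, fermionEmbed_shiftEmb_nAt, fermionEmbed_shiftEmb_nAt, map_smul, map_one]

/-- The centred density `n_x - ρ` is Hermitian. [folklore] -/
private theorem conjTranspose_density_sub {Λ : Finset (Site d)} (x : Site d) (hx : x ∈ Λ) (ρ : ℝ) :
    (nAt x hx 0 + nAt x hx 1 - (ρ : ℂ) • (1 : FermionOp Λ))ᴴ =
      nAt x hx 0 + nAt x hx 1 - (ρ : ℂ) • (1 : FermionOp Λ) := by
  have h0 : (nAt x hx 0 : FermionOp Λ)ᴴ = nAt x hx 0 := (numberAt_isHermitian _).eq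
  have h1 : (nAt x hx 1 : FermionOp Λ)ᴴ = nAt x hx 1 := (numberAt_isHermitian _).eq
  rw [Matrix.conjTranspose_sub, Matrix.conjTranspose_add, h0, h1, Matrix.conjTranspose_smul,
    Matrix.conjTranspose_one, Complex.star_def, Complex.conj_ofReal]

/-- **The connected density–density correlation function of a translation-invariant state is
positive definite**: for every real `ρ`, `r ↦ ω((n₀ - ρ)(n_r - ρ))` (two-point function of the
centred density `n₀ - ρ ∈ 𝔄_{{0}}` and its translate `n_r - ρ ∈ 𝔄_{{r}}`, `n_x = n_{x↑} + n_{x↓}`)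
is positive definite on `ℤᵈ`. With `ρ` the density of `ω` this is the function whose Herglotz
measure is the (static) structure factor; its atoms are the long-range-order parameters.
[cite: BratteliRobinsonI1987, Cor. 2.3.17 and §4.3.1] -/
theorem IsTranslationInvariant.isPositiveDefinite_densityCorr (hω : ω.IsTranslationInvariant) (ρ : ℝ) :
    IsPositiveDefinite (fun r : Site d =>
      ω.corr (nAt (0 : Site d) (Finset.mem_singleton_self 0) 0 + nAt 0 (Finset.mem_singleton_self 0) 1 -
          (ρ : ℂ) • (1 : FermionOp ({0} : Finset (Site d))))
        (nAt (0 + r) (PolySite.add_mem_shiftSet r (Finset.mem_singleton_self 0)) 0 +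
          nAt (0 + r) (PolySite.add_mem_shiftSet r (Finset.mem_singleton_self 0)) 1 -
          (ρ : ℂ) • (1 : FermionOp (shiftSet r ({0} : Finset (Site d)))))) := by
  have h := hω.isPositiveDefinite_corr
    (nAt (0 : Site d) (Finset.mem_singleton_self 0) 0 + nAt 0 (Finset.mem_singleton_self 0) 1 -
      (ρ : ℂ) • (1 : FermionOp ({0} : Finset (Site d))))
  refine fun n x c => ?_
  have h' := h n x c
  simp only [conjTranspose_density_sub, fermionEmbed_shiftEmb_density_sub] at h'
  exact h'

/-- **One-site observables**: for a translation-invariant state and any one-site observable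
`a ∈ 𝔄_{{0}}` (a polynomial in `c_{0σ}, c†_{0σ}`; e.g. a spin component `S^α_0`, the double
occupancy `n_{0↑}n_{0↓}`), `r ↦ ω(a⋆ · τ_r a)` is positive definite on `ℤᵈ`; for Hermitian `a` this
is `r ↦ ω(a_0 a_r)`, and sums over components (`IsPositiveDefinite.sum`) give e.g.
`r ↦ ω(𝐒_0 · 𝐒_r)`. [cite: BratteliRobinsonI1987, Cor. 2.3.17 and §4.3.1] -/
theorem IsTranslationInvariant.isPositiveDefinite_corr_oneSite (hω : ω.IsTranslationInvariant)
    (a : FermionOp ({0} : Finset (Site d))) :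
    IsPositiveDefinite (fun r : Site d => ω.corr aᴴ (fermionEmbed (PolySite.shiftEmb r {0}) a)) :=
  hω.isPositiveDefinite_corr a

end InfVolFermionState

end Literature.MathematicalPhysics.QuantumLattice

end
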